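import Literature.AlgebraicGeometry.Resolution.PointBlowupMohBound
import Mathlib.Algebra.CharP.Lemmas
import HarnessLib

/-!
# An increase of the shade at an equimultiple point needs order at least `2p`

Topic: `Literature/AlgebraicGeometry/Resolution`. Reproduction (cell `pub-hironaka`, unit
`b2b-hironaka-cp4`, DIM-4 CENSUS gen 12; companion of `PointBlowupMohBound.lean`) of assertion
(2) of

* H. Hauser, S. Perlega, *Characterizing the increase of the residual order under blowup in
  positive characteristic*, Publ. RIMS **55** (2019) 835–857 = arXiv:1906.09593
  [HauserPerlega2019PRIMS], §3 Theorem: under an increase of the residual order at constant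
  order `c`, "(2) the order `o` of the coefficient ideal … is a multiple `o = w·c!` of `c!`, with
  `w ≥ 2`". For the purely inseparable hypersurface `x^p + F(y)` (`c = p`) the coefficient ideal
  is `(F)^{(p−1)!}`, so `o = (p−1)!·ord₀ F` and the assertion reads: **`ord₀ F = w·p` with
  `w ≥ 2`**. The divisibility `p ∣ ord₀ F` is `PointBlowup.necessary_of_shadeIncreases` (i)
  (= Hauser's condition (1) `OrderCondition`, [Hauser2010] §G); this file adds `w ≥ 2`.

## What is proved (every field of characteristic `p`, every number of residual variables)

* `two_mul_le_ordZero_of_shadeIncreases`: for a cleaned state `(F, r)` with `y^r ∣ F`,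
  `ord₀ F ≥ p`, and a point `b` of the `y_j`-chart (`b_j = 0`) at which the shade increases AND
  the new residual polynomial has order `≥ p` (the point is equiconstant for `x^p + F`):
  `2p ≤ ord₀ F`;
* `two_mul_le_ordZero_of_isKangarooPoint`: the same with the atlas predicate `IsKangarooPoint`;
* `two_mul_le_ordZero_of_lt_along`: along a sequence of point blow-ups on the equimultiple branch
  every increase happens from a state of order `≥ 2p`.

The equimultiplicity hypothesis is necessary in the model: for `F = y₁y₂`, `r = (1,1)`, `p = 2`,
`ord₀ F = p` and the shade "increases" (`0 ↦ 1`) at the point `b₁ = 1` of the `y₂`-chart, where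
the new residual polynomial `y₁` has order `1 < p` (cf. the reading note R-Moh-1 (2) in
`PointBlowupMohBound.lean`: the one-step theorems hold at every point, the datum being
meaningful only at equiconstant ones).

## Proof (derived here in the model's terms; [HP19b] argue via their invariant `ℓ` and oblique
## polynomials)

If `ord₀ F = p` then, `i₀` being the lost exceptional component of
`exists_nonexceptional_of_shadeIncreases`, the new order `|r′| + shade + 1 ≥ p` forces
`r = e_{i₀}` (`|r′| + r_j + Σ_{lost} r_i ≤ |r|`), so every index other than `j, i₀` is
untranslated or non-exceptional and by `necessary_of_shadeIncreases` (ii) enters the initial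
form with exponents `≡ 0 (mod p)`, hence `= 0` (total degree `p`, `d_{i₀} ≥ 1`): the initial
monomials are `y_j^{p−n} y_{i₀}^{n}`, `1 ≤ n ≤ p`, with chart exponents `n·e_{i₀}`. On the layer
`E_j = 0` the translated chart transform therefore coincides with `translate b G₀`,
`G₀ = Σ_n c_n y_{i₀}^n`; its monomials `y_{i₀}^m`, `1 ≤ m ≤ p − 1`, are not `p`-th powers and
have degree `< p ≤` the new order, so their coefficients vanish; thus `translate b G₀ = c₀ +
c₁ y_{i₀}^p`, and translating back (`translate_neg_translate`, `(y − β)^p = y^p − β^p`)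
`G₀ = c₀′ + c₁ y_{i₀}^p`: the only initial monomial is `y_{i₀}^p`, a `p`-th power in a cleaned
`F` — contradiction.

Census value only (row O5 of the dimension-4 census of `pub-hironaka`: at multiplicity `p` the
first increase of the classical residual datum can only occur once `|r| + shade ≥ 2p`).
-/

noncomputable section

open MvPolynomial Finset

open scoped BigOperators

namespace Literature.AlgebraicGeometry.Resolution

open Literature.AlgebraicGeometry.Resolution.Hauser2010
open Literature.Barriers.ResolutionOfSingularities
open Literature.AlgebraicGeometry.Resolution.WeightedBlowup

namespace PointBlowup

section Main

variable {σ : Type*} {K : Type*} [Field K] [Fintype σ] [DecidableEq σ] [DecidableEq K]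
variable (p : ℕ) [hp : Fact p.Prime] [CharP K p]

/-- **Hauser–Perlega's assertion (2) for `c = p`: an increase of the shade at an EQUIMULTIPLE
point requires `ord₀ F ≥ 2p`.** ("the order `o` of the coefficient ideal … is a multiple
`o = w·c!` of `c!`, with `w ≥ 2`", [HauserPerlega2019PRIMS] §3 Theorem (2); for the
hypersurface `x^p + F` the coefficient ideal is `(F)^{(p−1)!}`, so `o = (p−1)!·ord₀ F` and
`w = ord₀ F / p`.) In the model: for a cleaned state `(F, r)` with `y^r ∣ F` and `ord₀ F ≥ p`,
if the shade increases at the point `b` of the `y_j`-chart AND the new residual polynomial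
still has order `≥ p` (the point is equiconstant for `x^p + F`), then `2p ≤ ord₀ F`. Proof
(derived here in the model's terms): `p ∣ ord₀ F` (`necessary_of_shadeIncreases`); if
`ord₀ F = p` then the new order `|r′| + shade + 1 ≥ p` forces `r = e_{i₀}` for the lost
component `i₀`, every initial monomial is `y_j^{p−n} y_{i₀}^{n}` (`n ≥ 1`), the lowest
`y_j`-layer of the transform is `Ψ(y_{i₀}) = Σ c_n (y_{i₀} + b_{i₀})^n` of degree `≤ p`, whose
monomials of degree `1, …, p−1` must be cleaned away, i.e. vanish; translating back,
`Σ c_n y_{i₀}^n = Ψ₀ + Ψ_p (y_{i₀} − b_{i₀})^p = (Ψ₀ − Ψ_p b_{i₀}^p) + Ψ_p y_{i₀}^p` in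
characteristic `p`, so the only initial monomial is `y_{i₀}^p` — a `p`-th power in a cleaned
`F`, contradiction. Without the equimultiplicity hypothesis the statement is false in the model
(`F = y₁y₂`, `r = (1,1)`, `p = 2`: the shade "increases" from `0` to `1` at the non-equiconstant
point `b₁ = 1` of the `y₂`-chart, where the new order is `1 < p`).
[cite: HauserPerlega2019PRIMS, §3 Theorem (2)] [cite: Hauser2010, §G Kangaroo Theorem (1)] -/
theorem two_mul_le_ordZero_of_shadeIncreases (j : σ) (b : σ → K) (hbj : b j = 0)
    (s : State σ K) (hclean : deletePthPowers p s.F = s.F) {o : ℕ} (ho : ordZero s.F = o)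
    (hpo : p ≤ o) (hr : ∀ d ∈ s.F.support, s.r ≤ d) (hinc : ShadeIncreases p j b s)
    (hord : (p : ℕ∞) ≤ ordZero (step p j b s).F) : 2 * p ≤ o := by
  by_contra hlt
  rw [not_le] at hlt
  have hp1 : 1 < p := hp.out.one_lt
  obtain ⟨hpdvd, -, -⟩ := necessary_of_shadeIncreases p j b hbj s hclean ho hpo hr hinc
  -- `o = p`; from now on we work with `p`
  have hop : o = p := by
    obtain ⟨w, hw⟩ := hpdvd
    have hw1 : w = 1 := by
      rcases Nat.lt_or_ge w 2 with h | h
      · interval_cases w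
        · omega
        · rfl
      · nlinarith
    rw [hw, hw1, mul_one]
  have hop' : ordZero s.F = (p : ℕ) := by rw [ho, hop]
  clear hlt hpdvd ho hpo hop o
  have hdeg := le_degree_of_ordZero_eq s hop'
  obtain ⟨-, hfix, -⟩ := necessary_of_shadeIncreases p j b hbj s hclean hop' le_rfl hr hinc
  obtain ⟨i₀, hi₀, hbi₀, hri₀, -, o₁, ho₁, ho₁eq, -⟩ :=
    exists_nonexceptional_of_shadeIncreases p j b hbj s hclean hop' le_rfl hr hinc
  have hpo₁ : p ≤ o₁ := by
    rw [ho₁] at hord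
    exact_mod_cast hord
  -- the new multiplicities `r′ = (r.update j 0).filter (b = 0)`, pointwise
  have hr1 : (step p j b s).r = (s.r.update j (p - p)).filter (fun i => b i = 0) :=
    newMult_eq p j b hbj s hop'
  have hr1k : ∀ k, (step p j b s).r k = if b k = 0 then (if k = j then 0 else s.r k) else 0 := by
    intro k
    rw [hr1, Finsupp.filter_apply, Finsupp.update_apply, Nat.sub_self]
  -- `|r′| + r_j + Σ_{i ∈ T′} r_i ≤ |r|` for any set `T′` of translated indices other than `j`
  have hsplit : ∀ T' : Finset σ, (∀ i ∈ T', i ≠ j ∧ b i ≠ 0) →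
      (step p j b s).r.degree + s.r j + ∑ i ∈ T', s.r i ≤ s.r.degree := by
    intro T' hT'
    have hpt : ∀ k, (step p j b s).r k + (if k = j then s.r j else 0) + (if k ∈ T' then s.r k else 0)
        ≤ s.r k := by
      intro k
      rw [hr1k]
      by_cases hkj : k = j
      · rw [hkj, if_pos hbj, if_pos rfl, if_pos rfl, if_neg (fun h => (hT' _ h).1 rfl)]
        omega
      · rw [if_neg hkj, if_neg hkj]
        by_cases hkT : k ∈ T'
        · rw [if_pos hkT, if_neg (hT' k hkT).2]
          omega
        · rw [if_neg hkT]
          split_ifs <;> omega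
    have hsum := Finset.sum_le_sum fun k (_ : k ∈ (Finset.univ : Finset σ)) => hpt k
    rw [Finset.sum_add_distrib, Finset.sum_add_distrib, Finset.sum_ite_eq' Finset.univ j,
      if_pos (Finset.mem_univ j), Finset.sum_ite_mem, Finset.univ_inter,
      ← Finsupp.degree_eq_sum, ← Finsupp.degree_eq_sum] at hsum
    exact hsum
  -- `|r| ≤ |r′| + 1` from the new order `≥ p`, hence `r_{i₀} = 1`, `r_j = 0`, other translated `r_i = 0`
  have hro : s.r.degree ≤ p := by
    obtain ⟨⟨d₀, hd₀, hd₀deg⟩, -⟩ := (ordZero_eq_nat_iff _ _).mp hop'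
    exact hd₀deg ▸ degree_le_degree_of_le (hr d₀ (MvPolynomial.mem_support_iff.mpr hd₀))
  have hsum1 : s.r.degree ≤ (step p j b s).r.degree + 1 := by omega
  have hone := hsplit {i₀} (fun i hi => by
    rw [Finset.mem_singleton] at hi; subst hi; exact ⟨hi₀, hbi₀⟩)
  rw [Finset.sum_singleton] at hone
  have hri₀1 : s.r i₀ = 1 := by omega
  have hrj0 : s.r j = 0 := by omega
  have hothers : ∀ i, i ≠ j → i ≠ i₀ → b i = 0 ∨ s.r i = 0 := by
    intro i hij hii
    by_cases hbi : b i = 0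
    · exact Or.inl hbi
    · right
      have htwo := hsplit {i₀, i} (fun k hk => by
        rw [Finset.mem_insert, Finset.mem_singleton] at hk
        rcases hk with rfl | rfl
        · exact ⟨hi₀, hbi₀⟩
        · exact ⟨hij, hbi⟩)
      rw [Finset.sum_pair (Ne.symm hii)] at htwo
      omega
  -- initial monomials are `y_j^{p−n} y_{i₀}^{n}` with `n ≥ 1`
  have hinit : ∀ d ∈ s.F.support, d.degree = p →
      1 ≤ d i₀ ∧ ∀ i, i ≠ j → i ≠ i₀ → d i = 0 := by
    intro d hd hdp
    have hdi₀ : 1 ≤ d i₀ := hri₀1 ▸ Finsupp.le_def.mp (hr d hd) i₀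
    refine ⟨hdi₀, fun i hij hii => ?_⟩
    have hdvd : p ∣ d i := hfix i hij (hothers i hij hii) d hd hdp
    have h1 := degree_eq_add_sum_erase i₀ d
    have h2 : d i ≤ ∑ k ∈ univ.erase i₀, d k :=
      Finset.single_le_sum (fun k _ => Nat.zero_le (d k))
        (Finset.mem_erase.mpr ⟨hii, Finset.mem_univ i⟩)
    rcases hdvd with ⟨w, hw⟩
    rcases Nat.eq_zero_or_pos w with h0 | hpos
    · rw [hw, h0, mul_zero]
    · exfalso
      have : p ≤ d i := by rw [hw]; exact Nat.le_mul_of_pos_right p hpos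
      omega
  -- hence the chart exponent of an initial `d` is `(d i₀)·e_{i₀}`
  have hchart : ∀ d ∈ s.F.support, d.degree = p →
      chartExponent p j d = Finsupp.single i₀ (d i₀) := by
    intro d hd hdp
    obtain ⟨-, hzero⟩ := hinit d hd hdp
    ext i
    rw [chartExponent_apply, Finsupp.single_apply]
    by_cases hij : i = j
    · subst hij; rw [if_pos rfl, if_neg hi₀, hdp, Nat.sub_self]
    · rw [if_neg hij]
      by_cases hii : i = i₀
      · subst hii; rw [if_pos rfl]
      · rw [if_neg (fun h => hii h.symm), hzero i hij hii]
  -- the lowest-layer polynomial `G₀ = Σ_{initial d} c_d y_{i₀}^{d_{i₀}}`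
  set I : Finset (σ →₀ ℕ) := s.F.support.filter fun d => d.degree = p with hI
  set G₀ : MvPolynomial σ K := ∑ d ∈ I, monomial (Finsupp.single i₀ (d i₀)) (coeff d s.F) with hG₀
  -- (i) on the layer `E_j = 0` the point transform and `translate b G₀` have the same coefficients
  have hlayer : ∀ E : σ →₀ ℕ, E j = 0 →
      coeff E (pointTransform p j b s) = coeff E (translate b G₀) := by
    intro E hEj
    rw [pointTransform_eq_sum, coeff_sum, hG₀, translate_eq_sum_support]
    -- rewrite the right-hand side termwise through the monomial expansion of `G₀`
    have hrhs : coeff E (∑ e ∈ (∑ d ∈ I, monomial (Finsupp.single i₀ (d i₀)) (coeff d s.F)).support,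
        translate b (monomial e (coeff e (∑ d ∈ I, monomial (Finsupp.single i₀ (d i₀))
          (coeff d s.F))))) =
        ∑ d ∈ I, coeff E (translate b (monomial (Finsupp.single i₀ (d i₀)) (coeff d s.F))) := by
      rw [← translate_eq_sum_support]
      unfold translate
      rw [map_sum, coeff_sum]
    rw [hrhs, hI, Finset.sum_filter]
    refine Finset.sum_congr rfl fun d hd => ?_
    by_cases hdp : d.degree = p
    · rw [if_pos hdp, hchart d hd hdp]
    · rw [if_neg hdp]
      by_contra hne
      have h1 := apply_eq_of_coeff_translate_monomial_ne_zero b hbj hne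
      rw [hEj, chartExponent_apply, if_pos rfl] at h1
      have h2 := hdeg d hd
      omega
  -- (ii) the coefficients of the point transform at `y_{i₀}^m`, `1 ≤ m < p`, vanish
  have hvanish : ∀ m, 1 ≤ m → m < p →
      coeff (Finsupp.single i₀ m) (pointTransform p j b s) = 0 := by
    intro m hm1 hmp
    have hnot : ¬ IsPthPowerExponent p (Finsupp.single i₀ m) := by
      intro h
      have := (isPthPowerExponent_iff p _).mp h i₀
      rw [Finsupp.single_eq_same] at this
      exact absurd (Nat.le_of_dvd (by omega) this) (by omega)
    have h1 : coeff (Finsupp.single i₀ m) (step p j b s).F = 0 := by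
      obtain ⟨-, hmin⟩ := (ordZero_eq_nat_iff _ _).mp ho₁
      exact hmin _ (by rw [Finsupp.degree_single]; omega)
    change coeff (Finsupp.single i₀ m) (deletePthPowers p (pointTransform p j b s)) = 0 at h1
    rwa [coeff_deletePthPowers, if_neg hnot] at h1
  -- (iii) `translate b G₀` is supported on `{0, p·e_{i₀}}`
  have hsuppG₀ : ∀ E ∈ G₀.support, ∃ n, n ≤ p ∧ E = Finsupp.single i₀ n := by
    intro E hE
    rw [hG₀] at hE
    obtain ⟨d, hd, -, rfl⟩ := exists_of_mem_support_sum_monomial _ _ _ hE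
    have hdI := Finset.mem_filter.mp hd
    exact ⟨d i₀, hdI.2 ▸ Finsupp.le_degree i₀ d, rfl⟩
  have hsuppT : ∀ E : σ →₀ ℕ, coeff E (translate b G₀) ≠ 0 → E = 0 ∨ E = Finsupp.single i₀ p := by
    intro E hE
    obtain ⟨E', hE', hle⟩ :=
      exists_le_of_mem_support_translate b G₀ (MvPolynomial.mem_support_iff.mpr hE)
    obtain ⟨n, hn, rfl⟩ := hsuppG₀ E' hE'
    have hE_eq : E = Finsupp.single i₀ (E i₀) := by
      ext i
      rw [Finsupp.single_apply]
      by_cases h : i₀ = i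
      · subst h; rw [if_pos rfl]
      · rw [if_neg h]
        have := Finsupp.le_def.mp hle i
        rw [Finsupp.single_apply, if_neg h] at this
        omega
    have hm : E i₀ ≤ p := by
      have := Finsupp.le_def.mp hle i₀
      rw [Finsupp.single_eq_same] at this
      omega
    rcases Nat.eq_zero_or_pos (E i₀) with h0 | hpos
    · left; rw [hE_eq, h0, Finsupp.single_zero]
    · rcases hm.lt_or_eq with hlt' | heq
      · exfalso
        have hEj : E j = 0 := by rw [hE_eq, Finsupp.single_apply, if_neg hi₀]
        rw [← hlayer E hEj, hE_eq] at hE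
        exact hE (hvanish (E i₀) hpos hlt')
      · right; rw [hE_eq, heq]
  -- (iv) translating back: `G₀ = c₀ + c₁ y_{i₀}^p`
  have hTform : translate b G₀ = C (coeff 0 (translate b G₀)) +
      C (coeff (Finsupp.single i₀ p) (translate b G₀)) * X i₀ ^ p := by
    classical
    rw [C_mul_X_pow_eq_monomial]
    ext E
    rw [coeff_add, coeff_C, coeff_monomial]
    have hp0 : (0 : σ →₀ ℕ) ≠ Finsupp.single i₀ p := by
      intro h
      have := DFunLike.congr_fun h i₀
      rw [Finsupp.single_eq_same, Finsupp.coe_zero, Pi.zero_apply] at this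
      omega
    by_cases h0 : E = 0
    · subst h0
      rw [if_pos rfl, if_neg (fun h => hp0 h.symm), add_zero]
    · rw [if_neg (fun h => h0 h.symm)]
      by_cases hp' : E = Finsupp.single i₀ p
      · subst hp'; rw [if_pos rfl, zero_add]
      · rw [if_neg (fun h => hp' h.symm), add_zero]
        by_contra hne
        rcases hsuppT E hne with h | h
        · exact h0 h
        · exact hp' h
  have hG₀form : ∃ c₀ c₁ : K, G₀ = C c₀ + C c₁ * X i₀ ^ p := by
    have hback := (translate_neg_translate b G₀).symm
    rw [hTform] at hback
    set a₀ := coeff 0 (translate b G₀)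
    set a₁ := coeff (Finsupp.single i₀ p) (translate b G₀)
    refine ⟨a₀ + a₁ * (-b i₀) ^ p, a₁, ?_⟩
    rw [hback]
    unfold translate
    rw [map_add, algHom_C, algebraMap_eq, map_mul, algHom_C, algebraMap_eq, map_pow, aeval_X,
      add_pow_char (x := (X i₀ : MvPolynomial σ K)) (y := C (-b i₀)) p, ← C_pow, map_add, map_mul]
    ring
  -- (v) compare coefficients: the initial monomial of least `i₀`-exponent must be `y_{i₀}^p`
  obtain ⟨c₀, c₁, hform⟩ := hG₀form
  have hcoeffG₀ : ∀ d ∈ I, coeff (Finsupp.single i₀ (d i₀)) G₀ = coeff d s.F := by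
    intro d hd
    rw [hG₀, coeff_sum_monomial_of_injOn I (fun d => Finsupp.single i₀ (d i₀))
      (fun d => coeff d s.F) hd]
    intro d' hd' _ h
    have hn : d' i₀ = d i₀ := by
      have := DFunLike.congr_fun h i₀
      rwa [Finsupp.single_eq_same, Finsupp.single_eq_same] at this
    have hdI := Finset.mem_filter.mp hd
    have hd'I := Finset.mem_filter.mp hd'
    have e1 := hchart d hdI.1 hdI.2
    have e2 := hchart d' hd'I.1 hd'I.2
    have : chartExponent p j d' = chartExponent p j d := by rw [e1, e2, hn]
    exact chartExponent_injective (le_of_eq hd'I.2.symm) (le_of_eq hdI.2.symm) this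
  obtain ⟨⟨d₀, hd₀, hd₀deg⟩, -⟩ := (ordZero_eq_nat_iff _ _).mp hop'
  have hd₀s : d₀ ∈ s.F.support := MvPolynomial.mem_support_iff.mpr hd₀
  have hd₀I : d₀ ∈ I := Finset.mem_filter.mpr ⟨hd₀s, hd₀deg⟩
  obtain ⟨hd₀i₀, hzero⟩ := hinit d₀ hd₀s hd₀deg
  have hd₀i₀p : d₀ i₀ = p := by
    by_contra hne
    have hlt' : d₀ i₀ < p := lt_of_le_of_ne (hd₀deg ▸ Finsupp.le_degree i₀ d₀) hne
    have h1 := hcoeffG₀ d₀ hd₀I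
    have hne0 : (0 : σ →₀ ℕ) ≠ Finsupp.single i₀ (d₀ i₀) := by
      intro h
      have := DFunLike.congr_fun h i₀
      rw [Finsupp.coe_zero, Pi.zero_apply, Finsupp.single_eq_same] at this
      omega
    have hnep : Finsupp.single i₀ p ≠ Finsupp.single i₀ (d₀ i₀) := by
      intro h
      have := DFunLike.congr_fun h i₀
      rw [Finsupp.single_eq_same, Finsupp.single_eq_same] at this
      omega
    rw [hform, coeff_add, coeff_C, if_neg hne0, coeff_C_mul, X_pow_eq_monomial, coeff_monomial,
      if_neg hnep, mul_zero, add_zero] at h1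
    exact hd₀ h1.symm
  -- so `d₀ = p·e_{i₀}` is a `p`-th power monomial of the cleaned `F`: contradiction
  apply not_isPthPowerExponent_of_clean p hclean hd₀s
  rw [isPthPowerExponent_iff]
  intro i
  by_cases hii : i = i₀
  · subst hii; rw [hd₀i₀p]
  · by_cases hij : i = j
    · subst hij
      have h1 := degree_eq_add_sum_erase i d₀
      have h2 : d₀ i₀ ≤ ∑ k ∈ univ.erase i, d₀ k :=
        Finset.single_le_sum (fun k _ => Nat.zero_le _)
          (Finset.mem_erase.mpr ⟨hi₀, Finset.mem_univ _⟩)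
      have : d₀ i = 0 := by omega
      rw [this]; exact dvd_zero p
    · rw [hzero i hij hii]; exact dvd_zero p

/-- **A kangaroo point needs order at least `2p`** (the same, phrased with the atlas predicate
`IsKangarooPoint` of `PointBlowupShade.lean`: `b_j = 0`, the point is equimultiple, the shade
increases). [cite: HauserPerlega2019PRIMS, §3 Theorem (2)] [cite: Hauser2010, §G Kangaroo Theorem] -/
theorem two_mul_le_ordZero_of_isKangarooPoint (j : σ) (b : σ → K) (s : State σ K)
    (hclean : deletePthPowers p s.F = s.F) {o : ℕ} (ho : ordZero s.F = o) (hpo : p ≤ o)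
    (hr : ∀ d ∈ s.F.support, s.r ≤ d) (hK : IsKangarooPoint p j b s) : 2 * p ≤ o := by
  obtain ⟨hbj, heq, hinc⟩ := hK
  exact two_mul_le_ordZero_of_shadeIncreases p j b hbj s hclean ho hpo hr hinc
    (le_ordZero_step_of_isEquimultiplePoint p j b s heq)

/-- **Along a sequence of point blow-ups on the equimultiple branch, every increase of the shade
happens from a state of order `≥ 2p`**, i.e. with `|r| + shade ≥ 2p`.
[cite: HauserPerlega2019PRIMS, §3 Theorem (2)] -/
theorem two_mul_le_ordZero_of_lt_along (s : ℕ → State σ K) (j : ℕ → σ) (b : ℕ → σ → K)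
    (hb : ∀ n, b n (j n) = 0) (hstep : ∀ n, s (n + 1) = step p (j n) (b n) (s n))
    (hF0 : (s 0).F ≠ 0) (hclean : deletePthPowers p (s 0).F = (s 0).F)
    (hr : ∀ d ∈ (s 0).F.support, (s 0).r ≤ d) (hord : ∀ n, (p : ℕ∞) ≤ ordZero (s n).F)
    {n : ℕ} (hlt : (s n).shade < (s (n + 1)).shade) :
    ((2 * p : ℕ) : ℕ∞) ≤ ordZero (s n).F := by
  -- invariants along the sequence: non-zero, cleaned, divisible by the exceptional monomial
  have hinv : ∀ n, (s n).F ≠ 0 ∧ deletePthPowers p (s n).F = (s n).F ∧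
      ∀ d ∈ (s n).F.support, (s n).r ≤ d := by
    intro n
    induction n with
    | zero => exact ⟨hF0, hclean, hr⟩
    | succ n ih =>
      obtain ⟨ih0, ih1, ih2⟩ := ih
      have hne : ordZero (s n).F ≠ ⊤ := by
        unfold ordZero
        rw [Ne, MvPowerSeries.order_eq_top_iff, MvPolynomial.coe_eq_zero_iff]
        exact ih0
      obtain ⟨o, ho'⟩ := WithTop.ne_top_iff_exists.mp hne
      have ho : ordZero (s n).F = o := ho'.symm
      have hpo : p ≤ o := by
        have := hord n
        rw [ho] at this
        exact_mod_cast this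
      rw [hstep n]
      exact ⟨step_F_ne_zero p (j n) (b n) (hb n) (s n) ih1 ho hpo ih2,
        deletePthPowers_step p (j n) (b n) (s n),
        newMult_le_of_mem_support_step p (j n) (b n) (hb n) (s n) ho ih2⟩
  obtain ⟨h0, h1, h2⟩ := hinv n
  have hne : ordZero (s n).F ≠ ⊤ := by
    unfold ordZero
    rw [Ne, MvPowerSeries.order_eq_top_iff, MvPolynomial.coe_eq_zero_iff]
    exact h0
  obtain ⟨o, ho'⟩ := WithTop.ne_top_iff_exists.mp hne
  have ho : ordZero (s n).F = o := ho'.symm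
  have hpo : p ≤ o := by
    have := hord n
    rw [ho] at this
    exact_mod_cast this
  have hinc : ShadeIncreases p (j n) (b n) (s n) := by
    unfold ShadeIncreases
    rw [← hstep n]
    exact hlt
  have hord1 : (p : ℕ∞) ≤ ordZero (step p (j n) (b n) (s n)).F := by
    rw [← hstep n]; exact hord (n + 1)
  have := two_mul_le_ordZero_of_shadeIncreases p (j n) (b n) (hb n) (s n) h1 ho hpo h2 hinc hord1
  rw [ho]
  exact_mod_cast this

end Main

end PointBlowup

end Literature.AlgebraicGeometry.Resolution
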